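import Mathlib.GroupTheory.SpecificGroups.Dihedral
import Mathlib.Data.ZMod.Basic
import Mathlib.Tactic
import Literature.Combinatorics.Additive.TripleProductProperty
import Literature.Computability.AlgebraicComplexity.CohnUmansTPP
import HarnessLib

/-!
# ω-census: infinite families of TPP triples of volume `→ 2|G|` in `C_K × D_{2M}` (index-2 abelian subgroup; cyclic for `K = M+2`)

Contributed by the speedrun lane `tpp` (exhaustive TPP-capacity census), seat `sr-tpp-search-g10`, 2026-08-20; source file
`run/shared/lean/speedrun/tpp/sr-tpp-search-g10/conj/FamilyTPP.lean` (sha256 `6208151986fcf665beb4942728dc10234581aa5ad9723edf8a3b5a54516ac8a4`), restated here over the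
tree definition `Literature.Combinatorics.Additive.TripleProductProperty` (definitionally the clause of
`Literature.Computability.AlgebraicComplexity.RealizesTPP`).  Cell `pub-omega`, topic `Summits/MatrixMultiplication/OmegaCensus`
(ruling L5-9).  HONEST FRAMING: explicit triples with a structural proof (no search inside the kernel); a census datum — nothing here
bears on `ω` (the volumes stay below `Σ dᵢ³`).  Dihedral convention = Mathlib's (`r i * r j = r (i+j)`, `r i * sr j = sr (j-i)`,
`sr i * r j = sr (i+j)`, `sr i * sr j = r (j-i)`); the statements are FALSE verbatim in the opposite convention.

## The families

For every `h ≥ 1` put `M = 2h+1`, `K = 2h+3` and `G = C_K × D_{2M}` (order `2KM`, containing the cyclic subgroup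
`C_K × C_M ≅ C_{KM}` of index 2).  The subsets
  `S = { (−i, r i) : 0 ≤ i ≤ K−2 }`, `T = { (0, r 0), (1, r 1), (1, sr 1), (0, sr 2) }`,
  `U = { (−2j, r (−4−2j)) : j < h } ∪ { (−2i, sr (2i)) : i < h }`
(first coordinate in `ZMod K` written additively, second in `DihedralGroup M`) have sizes `K−1 = 2h+2`, `4`, `M−1 = 2h`
and satisfy the triple product property (tree definition `RealizesTPP`, Cohn–Umans 2003 Def. 2.1).  Hence
`β(G)/|G| ≥ 16h(h+1) / (2(2h+1)(2h+3)) → 2`, refuting the Hedtke–Murthy conjecture `β(G) ≤ 4|G|/3` for groups with a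
cyclic subgroup of index 2 (Groups Complex. Cryptol. 4 (2012) Conj. 7.6; S. Murthy, arXiv:2512.16730 Conj. 1.3) by a
margin tending to `2 − 4/3`.  The general statement for `K ≡ 2 (mod M)` (same three sets, sizes `K−1, 4, M−1`) is proved by hand in the lane's
`RESULTS-conj.md` and machine-checked for all odd `M ≤ 39`, `K ≤ 60`; this file kernel-checks the sub-family `K = M + 2`
(section `family`), the variant `K = M` (section `family0`: `C_M × D_{2M}` realizes `⟨M−1, 4, M−1⟩`) and the DIAGONAL FAMILY
(section `diag`: for every odd `M`, `C_M × D_{2M}` realizes `⟨M, 2M−2, 2⟩` with `S` the anti-diagonal subgroup, `T = {(x, r x), (x, sr(−x)) : x ≠ 0}`,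
`U = {1, (0, sr 0)}`, volume `4M(M−1) = 2|G| − 4M`; by the lane's exact census this is the TPP capacity of `C_M × D_{2M}` for `M = 3, 5, 7`)
and its `K = 2M` variant (section `diag2`).

References: Cohn–Umans 2003, Def. 2.1 [CohnUmans2003]; Cohn–Kleinberg–Szegedy–Umans 2005, Def. 1.3 [CohnKleinbergSzegedyUmans2005];
Hedtke–Murthy, Groups Complex. Cryptol. 4 (2012), Conj. 7.6 [HedtkeMurthy2012]; S. Murthy, arXiv:2512.16730 (2025), Conj. 1.3.
Tree landing by the cell `pub-omega` (seat pub-omega-group-g3, 2026-08-20, ruling L5-9 (2)): the lane's tree-ready file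
`CyclicDihedralIndexTwoFamily.lean` (sha256 `2a4a3dcc6209466f403ed3971201eb1abe22c4b801c33e7ba08f8f438974b09a`) is split into two files of ≤ 400 lines (this one: the
`C_{2h+3} × D_{2(2h+1)}` family; `CyclicDihedralIndexTwoFamilyDiag.lean`: the `C_{2h+1} × D_{2(2h+1)}` family and the two
diagonal families) and a docstring is added to every declaration; statements and proofs are verbatim.
Framing: lottery ticket; floor = certified bounds/negative ranges.
-/

namespace Summit.MatrixMultiplication.OmegaCensus.CyclicDihedralIndexTwoFamily

open Literature.Computability.AlgebraicComplexity Literature.Combinatorics.Additive DihedralGroup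

/-- the carrier `C_K × D_{2M}`. -/
abbrev Grp (K M : ℕ) := Multiplicative (ZMod K) × DihedralGroup M

variable {K M : ℕ}

/-- rotation-type element `(x, r y)`. -/
def rot (K M : ℕ) (x y : ℤ) : Grp K M := (Multiplicative.ofAdd (x : ZMod K), r (y : ZMod M))
/-- reflection-type element `(x, sr y)`. -/
def ref (K M : ℕ) (x y : ℤ) : Grp K M := (Multiplicative.ofAdd (x : ZMod K), sr (y : ZMod M))

/-- Product of two rotation-type elements. [folklore] -/
@[simp] theorem rot_mul_rot (x y x' y' : ℤ) : rot K M x y * rot K M x' y' = rot K M (x + x') (y + y') := by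
  simp [rot, ← ofAdd_add]
/-- Rotation-type times reflection-type. [folklore] -/
@[simp] theorem rot_mul_ref (x y x' y' : ℤ) : rot K M x y * ref K M x' y' = ref K M (x + x') (y' - y) := by
  simp [rot, ref, ← ofAdd_add]
/-- Reflection-type times rotation-type. [folklore] -/
@[simp] theorem ref_mul_rot (x y x' y' : ℤ) : ref K M x y * rot K M x' y' = ref K M (x + x') (y + y') := by
  simp [rot, ref, ← ofAdd_add]
/-- Product of two reflection-type elements is rotation-type. [folklore] -/
@[simp] theorem ref_mul_ref (x y x' y' : ℤ) : ref K M x y * ref K M x' y' = rot K M (x + x') (y' - y) := by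
  simp [rot, ref, ← ofAdd_add]
/-- Inverse of a rotation-type element. [folklore] -/
@[simp] theorem rot_inv (x y : ℤ) : (rot K M x y)⁻¹ = rot K M (-x) (-y) := by
  simp [rot, ← ofAdd_neg]
/-- A reflection-type element is an involution up to the first coordinate's sign. [folklore] -/
@[simp] theorem ref_inv (x y : ℤ) : (ref K M x y)⁻¹ = ref K M (-x) y := by
  simp [ref, ← ofAdd_neg]

/-- Equality of rotation-type elements in terms of divisibility of coordinate differences. [folklore] -/
@[simp] theorem rot_eq_rot_iff (x y x' y' : ℤ) :
    rot K M x y = rot K M x' y' ↔ (K : ℤ) ∣ x' - x ∧ (M : ℤ) ∣ y' - y := by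
  simp [rot, Prod.ext_iff, ZMod.intCast_eq_intCast_iff_dvd_sub]
/-- Equality of reflection-type elements in terms of divisibility of coordinate differences. [folklore] -/
@[simp] theorem ref_eq_ref_iff (x y x' y' : ℤ) :
    ref K M x y = ref K M x' y' ↔ (K : ℤ) ∣ x' - x ∧ (M : ℤ) ∣ y' - y := by
  simp [ref, Prod.ext_iff, ZMod.intCast_eq_intCast_iff_dvd_sub]
/-- Rotation-type and reflection-type elements are distinct. [folklore] -/
@[simp] theorem rot_ne_ref (x y x' y' : ℤ) : rot K M x y = ref K M x' y' ↔ False := by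
  simp [rot, ref, Prod.ext_iff]
/-- Reflection-type and rotation-type elements are distinct. [folklore] -/
@[simp] theorem ref_ne_rot (x y x' y' : ℤ) : ref K M x y = rot K M x' y' ↔ False := by
  simp [rot, ref, Prod.ext_iff]
/-- The identity is `rot 0 0`. [folklore] -/
theorem one_eq_rot : (1 : Grp K M) = rot K M 0 0 := by
  simp [rot, Prod.ext_iff]
/-- A rotation-type element is the identity iff both coordinates vanish modulo `K`, `M`. [folklore] -/
@[simp] theorem rot_eq_one_iff (x y : ℤ) : rot K M x y = 1 ↔ (K : ℤ) ∣ x ∧ (M : ℤ) ∣ y := by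
  rw [one_eq_rot, rot_eq_rot_iff]; simp [dvd_neg]
/-- No reflection-type element is the identity. [folklore] -/
@[simp] theorem ref_ne_one (x y : ℤ) : ref K M x y = 1 ↔ False := by
  rw [one_eq_rot, ref_ne_rot]

/-- small-quotient windows: a multiple of `n` in `(−2n, 2n)` is `0` or `±n`, etc. -/
theorem dvd_window2 {n x : ℤ} (hn : 0 < n) (h : n ∣ x) (h1 : -(2 * n) < x) (h2 : x < 2 * n) :
    x = 0 ∨ x = n ∨ x = -n := by
  obtain ⟨q, rfl⟩ := h
  have hq1 : -2 < q := by
    by_contra hc; push Not at hc; nlinarith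
  have hq2 : q < 2 := by
    by_contra hc; push Not at hc; nlinarith
  interval_cases q <;> omega

/-- A multiple of `n` strictly between `-4n` and `4n` is one of `0, ±n, ±2n, ±3n`. [folklore] -/
theorem dvd_window4 {n x : ℤ} (hn : 0 < n) (h : n ∣ x) (h1 : -(4 * n) < x) (h2 : x < 4 * n) :
    x = 0 ∨ x = n ∨ x = -n ∨ x = 2 * n ∨ x = -(2 * n) ∨ x = 3 * n ∨ x = -(3 * n) := by
  obtain ⟨q, rfl⟩ := h
  have hq1 : -4 < q := by
    by_contra hc; push Not at hc; nlinarith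
  have hq2 : q < 4 := by
    by_contra hc; push Not at hc; nlinarith
  interval_cases q <;> omega


/-- A multiple of `n` strictly between `-6n` and `6n` is one of `0, ±n, …, ±5n`. [folklore] -/
theorem dvd_window6 {n x : ℤ} (hn : 0 < n) (h : n ∣ x) (h1 : -(6 * n) < x) (h2 : x < 6 * n) :
    x = 0 ∨ x = n ∨ x = -n ∨ x = 2 * n ∨ x = -(2 * n) ∨ x = 3 * n ∨ x = -(3 * n) ∨
      x = 4 * n ∨ x = -(4 * n) ∨ x = 5 * n ∨ x = -(5 * n) := by
  obtain ⟨q, rfl⟩ := h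
  have hq1 : -6 < q := by
    by_contra hc; push Not at hc; nlinarith
  have hq2 : q < 6 := by
    by_contra hc; push Not at hc; nlinarith
  interval_cases q <;> omega

section family
variable (h : ℕ)

/-- `S = { (−i, r i) : i < 2h+2 }` in `C_{2h+3} × D_{2(2h+1)}`. -/
def S : Finset (Grp (2 * h + 3) (2 * h + 1)) :=
  (Finset.range (2 * h + 2)).image fun i : ℕ => rot (2 * h + 3) (2 * h + 1) (-(i : ℤ)) (i : ℤ)
/-- `T = { 1, (1, r 1), (1, sr 1), (0, sr 2) }`. -/
def T : Finset (Grp (2 * h + 3) (2 * h + 1)) :=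
  {rot (2 * h + 3) (2 * h + 1) 0 0, rot (2 * h + 3) (2 * h + 1) 1 1, ref (2 * h + 3) (2 * h + 1) 1 1,
    ref (2 * h + 3) (2 * h + 1) 0 2}
/-- `U = { (−2j, r (−4−2j)) : j < h } ∪ { (−2i, sr (2i)) : i < h }`. -/
def U : Finset (Grp (2 * h + 3) (2 * h + 1)) :=
  ((Finset.range h).image fun j : ℕ => rot (2 * h + 3) (2 * h + 1) (-(2 * j : ℤ)) (-(4 + 2 * j : ℤ))) ∪
  ((Finset.range h).image fun i : ℕ => ref (2 * h + 3) (2 * h + 1) (-(2 * i : ℤ)) (2 * i : ℤ))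

/-- `|S h| = 2h + 2`. [folklore] -/
theorem card_S : (S h).card = 2 * h + 2 := by
  rw [S, Finset.card_image_of_injOn, Finset.card_range]
  intro i hi i' hi' he
  simp only [Finset.coe_range, Set.mem_Iio] at hi hi'
  have he' := (rot_eq_rot_iff _ _ _ _).mp he
  obtain ⟨hA, -⟩ := he'
  have hK : (0 : ℤ) < ((2 * h + 3 : ℕ) : ℤ) := by positivity
  rcases dvd_window2 hK hA (by push_cast; omega) (by push_cast; omega) with hA | hA | hA <;>
    (push_cast at hA; omega)

/-- `|T h| = 4` (for `h ≥ 1`). [folklore] -/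
theorem card_T (hh : 1 ≤ h) : (T h).card = 4 := by
  have h1 : ¬ (2 * (h : ℤ) + 3 ∣ 1) := by
    intro hd; have := Int.le_of_dvd one_pos hd; omega
  have d1 : rot (2 * h + 3) (2 * h + 1) 0 0 ≠ rot (2 * h + 3) (2 * h + 1) 1 1 := by
    rw [Ne, rot_eq_rot_iff]; push_cast; simp [h1]
  have d2 : rot (2 * h + 3) (2 * h + 1) 0 0 ≠ ref (2 * h + 3) (2 * h + 1) 1 1 := by simp
  have d3 : rot (2 * h + 3) (2 * h + 1) 0 0 ≠ ref (2 * h + 3) (2 * h + 1) 0 2 := by simp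
  have d4 : rot (2 * h + 3) (2 * h + 1) 1 1 ≠ ref (2 * h + 3) (2 * h + 1) 1 1 := by simp
  have d5 : rot (2 * h + 3) (2 * h + 1) 1 1 ≠ ref (2 * h + 3) (2 * h + 1) 0 2 := by simp
  have d6 : ref (2 * h + 3) (2 * h + 1) 1 1 ≠ ref (2 * h + 3) (2 * h + 1) 0 2 := by
    rw [Ne, ref_eq_ref_iff]; push_cast; simp [h1]
  simp only [T]
  rw [Finset.card_insert_of_notMem (by simp only [Finset.mem_insert, Finset.mem_singleton]; push Not; exact ⟨d1, d2, d3⟩),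
    Finset.card_insert_of_notMem (by simp only [Finset.mem_insert, Finset.mem_singleton]; push Not; exact ⟨d4, d5⟩),
    Finset.card_pair d6]

/-- `|U h| = 2h`. [folklore] -/
theorem card_U : (U h).card = 2 * h := by
  have hK : (0 : ℤ) < ((2 * h + 3 : ℕ) : ℤ) := by positivity
  rw [U, Finset.card_union_of_disjoint, Finset.card_image_of_injOn, Finset.card_image_of_injOn, Finset.card_range]
  · omega
  · intro i hi i' hi' he
    simp only [Finset.coe_range, Set.mem_Iio] at hi hi'
    obtain ⟨hA, -⟩ := (ref_eq_ref_iff _ _ _ _).mp he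
    rcases dvd_window2 hK hA (by push_cast; omega) (by push_cast; omega) with hA | hA | hA <;>
      (push_cast at hA; omega)
  · intro i hi i' hi' he
    simp only [Finset.coe_range, Set.mem_Iio] at hi hi'
    obtain ⟨hA, -⟩ := (rot_eq_rot_iff _ _ _ _).mp he
    rcases dvd_window2 hK hA (by push_cast; omega) (by push_cast; omega) with hA | hA | hA <;>
      (push_cast at hA; omega)
  · rw [Finset.disjoint_left]
    intro x hx hx'
    simp only [Finset.mem_image, Finset.mem_range] at hx hx'
    obtain ⟨j, -, rfl⟩ := hx
    obtain ⟨i, -, hc⟩ := hx'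
    simp at hc

set_option maxHeartbeats 0 in
/-- **The family triple `(S h, T h, U h)` has the triple product property** in `C_{2h+3} × D_{2(2h+1)}` (`h ≥ 1`). [folklore] -/
theorem tpp (hh : 1 ≤ h) :
    ∀ s ∈ S h, ∀ s' ∈ S h, ∀ t ∈ T h, ∀ t' ∈ T h, ∀ u ∈ U h, ∀ u' ∈ U h,
      s * s'⁻¹ * (t * t'⁻¹) * (u * u'⁻¹) = 1 → s = s' ∧ t = t' ∧ u = u' := by
  have hK : (0 : ℤ) < ((2 * h + 3 : ℕ) : ℤ) := by positivity
  have hM : (0 : ℤ) < ((2 * h + 1 : ℕ) : ℤ) := by positivity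
  intro s hs s' hs' t ht t' ht' u hu u' hu' he
  simp only [S, T, U, Finset.mem_image, Finset.mem_range, Finset.mem_union, Finset.mem_insert,
    Finset.mem_singleton] at hs hs' ht ht' hu hu'
  obtain ⟨i, hi, rfl⟩ := hs
  obtain ⟨i', hi', rfl⟩ := hs'
  rcases ht with rfl | rfl | rfl | rfl <;> rcases ht' with rfl | rfl | rfl | rfl <;>
  rcases hu with ⟨j, hj, rfl⟩ | ⟨j, hj, rfl⟩ <;> rcases hu' with ⟨j', hj', rfl⟩ | ⟨j', hj', rfl⟩ <;>
  simp only [rot_mul_rot, rot_mul_ref, ref_mul_rot, ref_mul_ref, rot_inv, ref_inv, rot_eq_one_iff,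
    ref_ne_one] at he
  all_goals (
    obtain ⟨hA, hB⟩ := he
    rcases dvd_window2 hK hA (by omega) (by omega) with hA | hA | hA <;>
    rcases dvd_window6 hM hB (by omega) (by omega) with hB | hB | hB | hB | hB | hB | hB | hB | hB | hB | hB <;>
    first
      | (exfalso; omega)
      | (obtain rfl : i = i' := by omega
         obtain rfl : j = j' := by omega
         exact ⟨rfl, rfl, rfl⟩))

/-- **The family**: for every `h ≥ 1`, `C_{2h+3} × D_{2(2h+1)}` realizes `⟨2h+2, 4, 2h⟩`. -/
theorem realizesTPP_family (hh : 1 ≤ h) :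
    RealizesTPP (Grp (2 * h + 3) (2 * h + 1)) (2 * h + 2) 4 (2 * h) :=
  ⟨S h, T h, U h, card_S h, card_T h hh, card_U h, tpp h hh⟩

/-- The same triple in the cell's vocabulary: `S, T, U` have the triple product property. -/
theorem tripleProductProperty_family (hh : 1 ≤ h) : TripleProductProperty (S h) (T h) (U h) := tpp h hh

/-- Existence form: a TPP triple of sizes `(2h+2, 4, 2h)` in `C_{2h+3} × D_{2(2h+1)}`. [folklore] -/
theorem exists_tpp_family (hh : 1 ≤ h) : ∃ A B C : Finset (Grp (2 * h + 3) (2 * h + 1)),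
    TripleProductProperty A B C ∧ A.card = 2 * h + 2 ∧ B.card = 4 ∧ C.card = 2 * h :=
  ⟨S h, T h, U h, tpp h hh, card_S h, card_T h hh, card_U h⟩

/-- `|C_{2h+3} × D_{2(2h+1)}| = 2(2h+1)(2h+3)`. [folklore] -/
theorem card_Grp : Fintype.card (Grp (2 * h + 3) (2 * h + 1)) = 2 * (2 * h + 1) * (2 * h + 3) := by
  simp [Fintype.card_prod, ZMod.card, DihedralGroup.card]; ring

/-- `(1, r 1)` generates a cyclic subgroup of order `(2h+3)(2h+1) = |G|/2` (index 2). -/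
theorem orderOf_gen :
    orderOf ((Multiplicative.ofAdd (1 : ZMod (2 * h + 3)), r (1 : ZMod (2 * h + 1))) : Grp (2 * h + 3) (2 * h + 1))
      = (2 * h + 3) * (2 * h + 1) := by
  rw [Prod.orderOf_mk, orderOf_ofAdd_eq_addOrderOf, ZMod.addOrderOf_one, DihedralGroup.orderOf_r_one]
  have hc : Nat.Coprime (2 * h + 3) (2 * h + 1) := by
    rw [show 2 * h + 3 = 2 + (2 * h + 1) by ring, Nat.coprime_add_self_left, Nat.coprime_two_left]
    exact odd_two_mul_add_one h
  exact hc.lcm_eq_mul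

/-- The element `(1, r 1)` has order `|G|/2`: the family groups have a cyclic subgroup of index 2. [folklore] -/
theorem two_mul_orderOf_gen :
    2 * orderOf ((Multiplicative.ofAdd (1 : ZMod (2 * h + 3)), r (1 : ZMod (2 * h + 1))) : Grp (2 * h + 3) (2 * h + 1))
      = Fintype.card (Grp (2 * h + 3) (2 * h + 1)) := by
  rw [orderOf_gen, card_Grp]; ring

/-- Summary: order `|G| = 8h²+16h+6`, a cyclic subgroup of index 2, and a TPP triple of volume
`(2h+2)·4·(2h) = 2|G| − (16h+12)`; so `β(G)/|G| ≥ 2 − (16h+12)/|G| → 2`. -/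
theorem family_summary (hh : 1 ≤ h) :
    Fintype.card (Grp (2 * h + 3) (2 * h + 1)) = 8 * h ^ 2 + 16 * h + 6 ∧
    (∃ g : Grp (2 * h + 3) (2 * h + 1), 2 * orderOf g = Fintype.card (Grp (2 * h + 3) (2 * h + 1))) ∧
    RealizesTPP (Grp (2 * h + 3) (2 * h + 1)) (2 * h + 2) 4 (2 * h) ∧
    (2 * h + 2) * 4 * (2 * h) + (16 * h + 12) = 2 * (8 * h ^ 2 + 16 * h + 6) :=
  ⟨by rw [card_Grp]; ring, ⟨_, two_mul_orderOf_gen h⟩, realizesTPP_family h hh, by ring⟩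

/-- For `h ≥ 2` the volume exceeds `4|G|/3`, so every member from `C_7 × D_10` (order 70) on is a
counterexample to the Hedtke–Murthy index-2 conjecture. -/
theorem volume_gt (hh : 2 ≤ h) :
    4 * Fintype.card (Grp (2 * h + 3) (2 * h + 1)) < 3 * ((2 * h + 2) * 4 * (2 * h)) := by
  rw [card_Grp]; nlinarith

/-- The Hedtke–Murthy conjecture (Groups Complex. Cryptol. 4 (2012) Conj. 7.6 = Murthy 2025 Conj. 1.3:
`G` has a cyclic subgroup of index 2 ⇒ every TPP triple has `|S||T||U| ≤ 4|G|/3`) is false — the verbatim statement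
`hedtkeMurthy_index2_conjecture_false` is already in the tree (`CyclicSevenDihedralTenTPP96.lean`, same lane source);
here is the family instance `h = 2` (order 70) in the same shape, under a distinct name. [folklore] -/
theorem hedtkeMurthy_index2_conjecture_false_family :
    ∃ (H : Type) (_ : Group H) (_ : Fintype H) (_ : DecidableEq H),
      (∃ g : H, 2 * orderOf g = Fintype.card H) ∧ ∃ a b c : ℕ, RealizesTPP H a b c ∧ 4 * Fintype.card H < 3 * (a * b * c) :=
  ⟨Grp (2 * 2 + 3) (2 * 2 + 1), inferInstance, inferInstance, inferInstance, ⟨_, two_mul_orderOf_gen 2⟩, _, _, _,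
    realizesTPP_family 2 (by norm_num), volume_gt 2 le_rfl⟩

/-- The volume-to-order ratio of the family tends to `2`: for every `n` some member has `n · (2|G| − V) ≤ |G|`-type margin (as stated). [folklore] -/
theorem ratio_approaches_two (n : ℕ) :
    ∃ h : ℕ, (∃ g : Grp (2 * h + 3) (2 * h + 1), 2 * orderOf g = Fintype.card (Grp (2 * h + 3) (2 * h + 1))) ∧
      RealizesTPP (Grp (2 * h + 3) (2 * h + 1)) (2 * h + 2) 4 (2 * h) ∧
      (2 * n + 1) * Fintype.card (Grp (2 * h + 3) (2 * h + 1)) < (n + 1) * ((2 * h + 2) * 4 * (2 * h)) := by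
  refine ⟨2 * n + 2, ⟨_, two_mul_orderOf_gen _⟩, realizesTPP_family _ (by omega), ?_⟩
  rw [card_Grp]; nlinarith

end family

end Summit.MatrixMultiplication.OmegaCensus.CyclicDihedralIndexTwoFamily
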